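import Summits.BirchSwinnertonDyer.BirchSwinnertonDyer.Theorems.KatoDescentTamePotSupersingularTameUpperNonsurjTowerTameThree
import Summits.BirchSwinnertonDyer.Rank1Residual.Additive.KatoDescentIrreducibleReadings
import Summits.BirchSwinnertonDyer.Rank1Residual.Additive.KatoDescentTorsionFree
import Summits.BirchSwinnertonDyer.Rank1Residual.O6.X3KatoMemberBoundMuDefect
import HarnessLib

/-!
# Route `KatoDescentTamePotSupersingular` (rung K8, sub-rung B4 (t′), cell `bsd-potss`): the row crux
# `TameUpperNonsurjTower` (U₀-ns, item stmt-BirchSwinnertonDyer-19202; child of U₀ = item 19982)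
# REDUCES TO ONE NAMED QUANTITY — `μ(𝐇²(T_pE)⁰) = 0` on its NON-CM rows — at every odd tame potentially
# supersingular prime (a `--supports … --as helper` file; the item is NOT closed)

Twin at a general odd additive prime of the K9 file
`KatoDescentPotSupersingularWildUpperNonsurjTowerOfMuZero.lean` (seat `bsd-potss-k9-c4`), composed with this
seat's reductions of the crux (`…TameUpperNonsurjTowerReduction`, `…TameUpperNonsurjTowerTameThree`):
the rows of item 19202 are the globally minimal `E/ℚ` of analytic rank `0`, `p` odd ADDITIVE of census type
(t′) (`SubTprime W p`: `f_p = 2`, potentially good, semistability index `e ∤ p − 1`), `E[p]` IRREDUCIBLE,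
`p`-adic tower image NOT onto. The surjective-mod-`p` rows are void (at `p = 3` by the tree theorem
`Additive.ClassX4.towerSurj_three_of_surj_of_subTprime`, at `p ≥ 5` by Serre's lifting lemma), the CM rows
are covered by row C8 (`missingUpperBoundAt_of_hasCM_rankZero`, granted the CM triple
`bsdTriple_of_hasCM_of_L_one_ne_zero`), so the live rows are the NON-CM ones with `ρ̄_{E,p}` irreducible and
not onto (`tameUpperNonsurjTower_of_cm_of_properModP_nonCM`). On them Kato's Thm. 12.5 (4) / 14.5 (3) /
13.4 (3) are void (no `σ` with `Coker(σ − 1)` free of rank one), and what Kato prints image-free —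
Thm. 12.4 (3), 12.5 (3), 12.6 + 13.14, 14.5 (1)–(2), §14.14–14.16 — gives, by the kernel theorem
`Irreducible.exists_shaAn_le_add_muInvariant` (k9-c4, `Additive/KatoDescentIrreducibleReadings.lean`, general
odd `p`), **`ord_p #Ш(E) ≤ ord_p #Ш_an(E) + μ(𝐇²(T_pE)⁰)` on every irreducible (t′) rank-`0` row** (§1).
Hence the crux follows from «`μ(𝐇²(T_pE)⁰) = 0` on its non-CM rows» (`Irreducible.H2MuZero`; =
Coates–Sujatha's Conjecture A for `(E,p)` up to finitely generated local terms; = Iwasawa's `μ`-conjecture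
for the cyclotomic `ℤ_p`-extension of the `p`-division field `ℚ(E[p])`, Reading I5) over the displayed
readings, the CM triple, GZK and modularity (§2); equivalently, in the kmc seat's hull currency, from
Reading Mμ with the interface `FineMuZero` (§3); and from Kato's Main Conjecture 12.10 at the rows (§4).
A parity sharpening (§1): a defect `μ ≤ 1` is harmless when `ord_p #Ш_an` is even. On the rows the group
`Gal(ℚ(E[p])/ℚ) = ρ̄_{E,p}(G_ℚ)` is an irreducible proper subgroup of `GL₂(𝔽_p)` containing a complex
conjugation (`det = −1`, non-scalar), hence NON-ABELIAN (an abelian irreducible subgroup lies in a non-split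
Cartan `𝔽_{p²}^×`, whose only involution is `−1`): Ferrero–Washington does not apply, and Iwasawa's
conjecture / Conjecture A is OPEN there. CONDITIONAL over displayed hypotheses (audit
`proof.conditional`); nothing about Kato's objects, Conjecture A, KMC or the CM triple is asserted; the
item is NOT closed. Seat `bsd-potss-k8t-c4` generation 2.

References: [Kato2004Asterisque] Thm. 12.4 (3) (p. 221), Thm. 12.5 (3)–(4), (12.5.2) (p. 222), Thm. 12.6
(p. 222), Thm. 13.4 (3) (p. 226), 13.14 (p. 234), Thm. 14.5 (1)–(3) (p. 236), §14.14 and Lemma 14.15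
(pp. 243–244), Prop. 14.16 (2) (p. 244), Conj. 12.10 (p. 224); [CoatesSujatha2005] Conj. A, Thm. 3.4;
[Wuthrich2014] Lemma 14 (p. 396), Lemma 20 (p. 399); [BurungaleFlach2024] Thm. 1.1, Cor. 2;
[SerreAbelianLadic1968] IV-23 Lemma 3; [Washington1997] §13.2; [SilvermanAEC2009] Thm. X.4.14.
-/

set_option autoImplicit false
-- sibling precedent (`KatoDescentPotSupersingularAssembly.lean`): the directory name repeats the summit name
set_option linter.dupNamespace false

noncomputable section

open scoped Classical

namespace Summit.BirchSwinnertonDyer.BirchSwinnertonDyer.Theorems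

open WeierstrassCurve Literature.NumberTheory.EllipticCurves
  Literature.NumberTheory.EllipticCurves.Rank1Residual
  Literature.NumberTheory.EllipticCurves.Rank1Residual.Typed
  Summit.BirchSwinnertonDyer.Rank1Residual.Additive
  Summit.BirchSwinnertonDyer.Rank1Residual
  Summit.BirchSwinnertonDyer.BirchSwinnertonDyer.Theses.KatoDescentTamePotSupersingular

variable {IsOf : ∀ (W : WeierstrassCurve ℚ) [W.IsElliptic] [W.IsGloballyMinimal] (p : ℕ) [Fact p.Prime],
  KatoDescentDatum p → Prop}
variable {KMC : ∀ (W : WeierstrassCurve ℚ) [W.IsElliptic] [W.IsGloballyMinimal] (p : ℕ), Prop}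
variable {IsHullOf : ∀ (W : WeierstrassCurve ℚ) [W.IsElliptic] [W.IsGloballyMinimal] (p : ℕ)
  [Fact p.Prime], KatoHullDescentDatum p → Prop}
variable {FineMuZero : ∀ (W : WeierstrassCurve ℚ) [W.IsElliptic], ℕ → Prop}

/-! ## §1 Kato's bound with the `μ`-defect on the irreducible (t′) rows; parity sharpening -/

/-- **Kato's bound WITH THE `μ`-DEFECT on every IRREDUCIBLE (t′) rank-`0` row (odd `p`, tower surjective or
not): `ord_p #Ш(E) ≤ ord_p #Ш_an(E) + μ(𝐇²(T_pE)⁰)`** on any realised Kato descent datum — over the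
image-free readings I2 (Thm. 12.5 (3)), I4 (Thm. 14.5 (1)–(2)), the kmc seat's count 1♭ (Prop. 14.16 (2)
etc.), GZK and modularity (`Irreducible.exists_shaAn_le_add_muInvariant`; additivity from `Addv`,
`0 ≤ ord_p j` from `ClassO5 := ⟨p ≠ 2, Addv, Or.inr SubTprime⟩`). The defect is the ONE named quantity the
crux `TameUpperNonsurjTower` hinges on. [cite: Kato2004Asterisque, Thm. 12.5 (3) (p. 222), Thm. 14.5 (1)–(3) (p. 236), §14.14 and Lemma 14.15 (pp. 243–244), Prop. 14.16 (2) (p. 244)]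
[cite: Washington1997, §13.2] -/
theorem tameUpper_irreducible_shaAn_le_add_muInvariant (hR : TorsionFree.DescentCountReading IsOf)
    (hdiv : Irreducible.DivisibilityOffP IsOf) (hz : Irreducible.ZetaIndexNeZero IsOf)
    (hGZK : rank_eq_analyticRank_of_analyticRank_le_one) (hmod : hasEntireLFunction_rat)
    (W : WeierstrassCurve ℚ) [W.IsElliptic] [W.IsGloballyMinimal] (p : ℕ) [Fact p.Prime]
    (hr : W.analyticRank = 0) (hp2 : p ≠ 2) (hadd : Addv W p) (hT : SubTprime W p)
    (hI : W.HasIrreducibleModPGaloisRep p) (D : KatoDescentDatum p) (hDof : IsOf W p D) :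
    ∃ q : ℚ, shaAn W = (q : ℂ) ∧ (padicValNat p W.shaOrder : ℤ) ≤ padicValRat p q + muInvariant p D.H2 :=
  have hO5 : ClassO5 W p := ⟨hp2, hadd, Or.inr hT⟩
  Irreducible.exists_shaAn_le_add_muInvariant W p hR hdiv hz hGZK hmod hr hp2 hadd
    hO5.padicValRat_j_nonneg hI D hDof

/-- **PARITY SHARPENING: a defect `μ(𝐇²(T_pE)⁰) ≤ 1` is harmless when `ord_p #Ш_an(E)` is even.** On an
irreducible (t′) rank-`0` row with a realised datum of `μ`-invariant `≤ 1` and `ord_p #Ш_an` even (a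
per-curve decidable modular-symbol certificate; NOT asserted), `ord_p #Ш ≤ ord_p #Ш_an + 1` with both sides
even (`#Ш` is a square: Cassels–Tate, named fact `exists_casselsTate_pairing` via
`isSquare_shaOrder_of_casselsTate`) gives the upper half. So only rows with `μ(𝐇²(T_pE)⁰) ≥ 2` (or odd
`ord_p #Ш_an`) can defeat the crux. [cite: Kato2004Asterisque, Thm. 12.5 (3) (p. 222), Thm. 14.5 (1)–(3) (p. 236)]
[cite: SilvermanAEC2009, Thm. X.4.14] [cite: Washington1997, §13.2] -/
theorem missingUpperBoundAt_tame_irreducible_of_muInvariant_le_one_of_even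
    (hR : TorsionFree.DescentCountReading IsOf)
    (hdiv : Irreducible.DivisibilityOffP IsOf) (hz : Irreducible.ZetaIndexNeZero IsOf)
    (hCT : exists_casselsTate_pairing (K := ℚ))
    (hGZK : rank_eq_analyticRank_of_analyticRank_le_one) (hmod : hasEntireLFunction_rat)
    (W : WeierstrassCurve ℚ) [W.IsElliptic] [W.IsGloballyMinimal] (p : ℕ) [Fact p.Prime]
    (hr : W.analyticRank = 0) (hp2 : p ≠ 2) (hadd : Addv W p) (hT : SubTprime W p)
    (hI : W.HasIrreducibleModPGaloisRep p) (D : KatoDescentDatum p) (hDof : IsOf W p D)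
    (hμ : muInvariant p D.H2 ≤ 1) (heven : ∀ q : ℚ, shaAn W = (q : ℂ) → Even (padicValRat p q)) :
    MissingUpperBoundAt W p := by
  obtain ⟨q, hq, hle⟩ :=
    tameUpper_irreducible_shaAn_le_add_muInvariant hR hdiv hz hGZK hmod W p hr hp2 hadd hT hI D hDof
  have hfin : W.ShaFinite := (hGZK W (by rw [hr]; exact zero_le_one)).2
  have hsq : IsSquare W.shaOrder := isSquare_shaOrder_of_casselsTate hCT W hfin
  obtain ⟨a, ha⟩ := O6.even_padicValNat_of_isSquare (p := p) hsq (W.shaOrder_pos hfin).ne'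
  obtain ⟨b, hb⟩ := heven q hq
  refine ⟨q, hq, ?_⟩
  have hμ' : (muInvariant p D.H2 : ℤ) ≤ 1 := by exact_mod_cast hμ
  have ha' : ((padicValNat p W.shaOrder : ℕ) : ℤ) = (a : ℤ) + (a : ℤ) := by exact_mod_cast ha
  omega

/-! ## §2 The crux by name from the named defect on its NON-CM rows (readings I2–I5 currency) -/

/-- **The row crux `TameUpperNonsurjTower` FOLLOWS FROM `μ(𝐇²(T_pE)⁰) = 0` ON ITS ROWS** (all of them, CM
or not; no CM input) — over the image-free readings I2–I4 (Thm. 12.5 (3); 12.4 (3) + 12.6 + 13.14; 14.5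
(1)–(2)), the count 1♭, GZK, modularity: for `W` (t′) of analytic rank `0` with `E[p]` irreducible and
non-surjective `p`-adic tower, `μ = 0` on the realised data (`Irreducible.H2MuZero IsOf W p`, asked ONLY on
the rows of the item) gives `MissingUpperBoundAt W p` by `Irreducible.missingUpperBoundAt_of_h2MuZero`.
Conditional over displayed hypotheses (Coates–Sujatha Conjecture A on these rows is NOT asserted); the
item is not closed. [cite: Kato2004Asterisque, Thm. 12.5 (3) (p. 222), Thm. 14.5 (1)–(3) (p. 236), Prop. 14.16 (2) (p. 244)]
[cite: CoatesSujatha2005, Conjecture A] -/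
theorem tameUpperNonsurjTower_of_h2MuZero (hR : TorsionFree.DescentCountReading IsOf)
    (hdiv : Irreducible.DivisibilityOffP IsOf) (hz : Irreducible.ZetaIndexNeZero IsOf)
    (hreal : Irreducible.Realizable IsOf)
    (hGZK : rank_eq_analyticRank_of_analyticRank_le_one) (hmod : hasEntireLFunction_rat)
    (hμ : ∀ (W : WeierstrassCurve ℚ) [W.IsElliptic] [W.IsGloballyMinimal] (p : ℕ) [Fact p.Prime],
      W.analyticRank = 0 → p ≠ 2 → Addv W p → SubTprime W p → W.HasIrreducibleModPGaloisRep p →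
      ¬ (∀ n : ℕ, W.HasSurjectiveModNGaloisRep (p ^ n : ℕ)) → Irreducible.H2MuZero IsOf W p) :
    Summit.BirchSwinnertonDyer.BirchSwinnertonDyer.Theses.KatoDescentTamePotSupersingular.TameUpperNonsurjTower := by
  intro W _ _ p _ hr hp2 hadd hT hI hns
  have hO5 : ClassO5 W p := ⟨hp2, hadd, Or.inr hT⟩
  exact Irreducible.missingUpperBoundAt_of_h2MuZero W p hR hdiv hz hreal hGZK hmod hr hp2 hadd
    hO5.padicValRat_j_nonneg hI (hμ W p hr hp2 hadd hT hI hns)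

/-- **The row crux `TameUpperNonsurjTower` FOLLOWS FROM `μ(𝐇²(T_pE)⁰) = 0` ON ITS NON-CM ROWS WITH `ρ̄_{E,p}`
NOT ONTO** — the CM rows being covered by row C8 (granted the CM triple `bsdTriple_of_hasCM_of_L_one_ne_zero`,
Rubin 1991 / Burungale–Flach 2024 Cor. 2, modularity, GZK) and the surjective-mod-`p` rows being void
(`tameUpperNonsurjTower_of_cm_of_properModP_nonCM`): over readings I2–I4, the count 1♭, GZK and modularity,
the named defect predicate asked ONLY on the non-CM rank-`0` (t′) rows with `E[p]` irreducible and `ρ̄_{E,p}`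
not onto (census of this seat: 411 pairs at `p ∈ {3,5,7}`, `N < 5·10⁵`) gives the crux BY NAME. Conditional;
nothing asserted; the item is not closed. [cite: Kato2004Asterisque, Thm. 12.5 (3) (p. 222), Thm. 14.5 (1)–(3) (p. 236), Prop. 14.16 (2) (p. 244)]
[cite: CoatesSujatha2005, Conjecture A] [cite: BurungaleFlach2024, Thm. 1.1 and Cor. 2 (p. 4)]
[cite: SerreAbelianLadic1968, Ch. IV §3.4 Lemma 3 (IV-23)] [cite: Wuthrich2014, Lemma 20 (p. 399)] -/
theorem tameUpperNonsurjTower_of_h2MuZero_nonCM (hR : TorsionFree.DescentCountReading IsOf)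
    (hdiv : Irreducible.DivisibilityOffP IsOf) (hz : Irreducible.ZetaIndexNeZero IsOf)
    (hreal : Irreducible.Realizable IsOf) (hCM : bsdTriple_of_hasCM_of_L_one_ne_zero)
    (hGZK : rank_eq_analyticRank_of_analyticRank_le_one) (hmod : hasEntireLFunction_rat)
    (hμ : ∀ (W : WeierstrassCurve ℚ) [W.IsElliptic] [W.IsGloballyMinimal] (p : ℕ) [Fact p.Prime],
      W.analyticRank = 0 → p ≠ 2 → Addv W p → SubTprime W p → ¬ W.HasCM →
      W.HasIrreducibleModPGaloisRep p → ¬ W.HasSurjectiveModNGaloisRep p →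
      Irreducible.H2MuZero IsOf W p) :
    Summit.BirchSwinnertonDyer.BirchSwinnertonDyer.Theses.KatoDescentTamePotSupersingular.TameUpperNonsurjTower :=
  tameUpperNonsurjTower_of_cm_of_properModP_nonCM hCM hmod hGZK fun W _ _ p _ hr hp2 hadd hT hcm hI hsp ↦
    have hO5 : ClassO5 W p := ⟨hp2, hadd, Or.inr hT⟩
    Irreducible.missingUpperBoundAt_of_h2MuZero W p hR hdiv hz hreal hGZK hmod hr hp2 hadd
      hO5.padicValRat_j_nonneg hI (hμ W p hr hp2 hadd hT hcm hI hsp)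

/-- **The row crux `TameUpperNonsurjTower` FOLLOWS FROM IWASAWA'S `μ`-INVARIANT CONJECTURE FOR THE
`p`-DIVISION FIELDS `ℚ(E[p])` OF ITS NON-CM ROWS** — over the image-free readings I2–I5 (Kato Thm. 12.5 (3);
12.4 (3) + 12.6 + 13.14; 14.5 (1)–(2); Coates–Sujatha Thm. 3.4 with Kato's global duality), the count 1♭, the
CM triple (row C8), GZK and modularity: the abstract predicate `IwMu W p` (intended binding: the unramified
Iwasawa module of the cyclotomic `ℤ_p`-extension of `ℚ(W[p])` is finitely generated over `ℤ_p`), asked ONLY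
on the non-CM rank-`0` (t′) rows with `E[p]` irreducible and `ρ̄_{E,p}` not onto, gives the item by
`Irreducible.missingUpperBoundAt_of_iwMu`. On those rows `Gal(ℚ(E[p])/ℚ)` is an irreducible proper subgroup
of `GL₂(𝔽_p)` containing a complex conjugation (non-scalar, `det = −1`), hence NON-ABELIAN (an abelian
irreducible subgroup lies in a non-split Cartan `𝔽_{p²}^×`, whose only involution is `−1`): the normaliser
of a Cartan subgroup or an exceptional image — Ferrero–Washington does not apply. The sharpest honest form
of the crux in the tree's vocabulary: a 1973 open problem of classical Iwasawa theory on a named family of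
number fields. Conditional; nothing asserted; the item is not closed.
[cite: CoatesSujatha2005, Conjecture A and Thm. 3.4] [cite: Kato2004Asterisque, Thm. 12.5 (3) (p. 222), Thm. 14.5 (1)–(3) (p. 236)]
[cite: Wuthrich2014, §4 (p. 395), Lemma 14 (p. 396)] [cite: BurungaleFlach2024, Thm. 1.1 and Cor. 2 (p. 4)] -/
theorem tameUpperNonsurjTower_of_iwMu_nonCM {IwMu : ∀ (W : WeierstrassCurve ℚ) [W.IsElliptic] (p : ℕ), Prop}
    (hR : TorsionFree.DescentCountReading IsOf)
    (hdiv : Irreducible.DivisibilityOffP IsOf) (hz : Irreducible.ZetaIndexNeZero IsOf)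
    (hreal : Irreducible.Realizable IsOf) (hA : Irreducible.ConjAReading IsOf IwMu)
    (hCM : bsdTriple_of_hasCM_of_L_one_ne_zero)
    (hGZK : rank_eq_analyticRank_of_analyticRank_le_one) (hmod : hasEntireLFunction_rat)
    (hμ : ∀ (W : WeierstrassCurve ℚ) [W.IsElliptic] [W.IsGloballyMinimal] (p : ℕ) [Fact p.Prime],
      W.analyticRank = 0 → p ≠ 2 → Addv W p → SubTprime W p → ¬ W.HasCM →
      W.HasIrreducibleModPGaloisRep p → ¬ W.HasSurjectiveModNGaloisRep p → IwMu W p) :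
    Summit.BirchSwinnertonDyer.BirchSwinnertonDyer.Theses.KatoDescentTamePotSupersingular.TameUpperNonsurjTower :=
  tameUpperNonsurjTower_of_cm_of_properModP_nonCM hCM hmod hGZK fun W _ _ p _ hr hp2 hadd hT hcm hI hsp ↦
    have hO5 : ClassO5 W p := ⟨hp2, hadd, Or.inr hT⟩
    Irreducible.missingUpperBoundAt_of_iwMu hR hdiv hz hreal hA hGZK hmod W p hr hp2 hadd
      hO5.padicValRat_j_nonneg hI (hμ W p hr hp2 hadd hT hcm hI hsp)

/-- **The crux `TameUpperNonsurjTower` from the WEAKER defect bound `μ(𝐇²(T_pE)⁰) ≤ 1` plus even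
`ord_p #Ш_an` on its non-CM rows with `ρ̄_{E,p}` not onto** (readings I2–I4, count 1♭, Cassels–Tate, the CM
triple, GZK, modularity): the parity sharpening run row by row, a datum existing by Reading I3. Conditional
over displayed hypotheses; nothing asserted; the item is not closed.
[cite: Kato2004Asterisque, Thm. 12.5 (3) (p. 222), Thm. 14.5 (1)–(3) (p. 236)] [cite: SilvermanAEC2009, Thm. X.4.14]
[cite: BurungaleFlach2024, Thm. 1.1 and Cor. 2 (p. 4)] -/
theorem tameUpperNonsurjTower_of_muInvariant_le_one_of_even_nonCM
    (hR : TorsionFree.DescentCountReading IsOf)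
    (hdiv : Irreducible.DivisibilityOffP IsOf) (hz : Irreducible.ZetaIndexNeZero IsOf)
    (hreal : Irreducible.Realizable IsOf) (hCT : exists_casselsTate_pairing (K := ℚ))
    (hCM : bsdTriple_of_hasCM_of_L_one_ne_zero)
    (hGZK : rank_eq_analyticRank_of_analyticRank_le_one) (hmod : hasEntireLFunction_rat)
    (hμ : ∀ (W : WeierstrassCurve ℚ) [W.IsElliptic] [W.IsGloballyMinimal] (p : ℕ) [Fact p.Prime],
      W.analyticRank = 0 → p ≠ 2 → Addv W p → SubTprime W p → ¬ W.HasCM →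
      W.HasIrreducibleModPGaloisRep p → ¬ W.HasSurjectiveModNGaloisRep p →
      ∀ D : KatoDescentDatum p, IsOf W p D → muInvariant p D.H2 ≤ 1)
    (heven : ∀ (W : WeierstrassCurve ℚ) [W.IsElliptic] [W.IsGloballyMinimal] (p : ℕ) [Fact p.Prime],
      W.analyticRank = 0 → p ≠ 2 → Addv W p → SubTprime W p → ¬ W.HasCM →
      W.HasIrreducibleModPGaloisRep p → ¬ W.HasSurjectiveModNGaloisRep p →
      ∀ q : ℚ, shaAn W = (q : ℂ) → Even (padicValRat p q)) :
    Summit.BirchSwinnertonDyer.BirchSwinnertonDyer.Theses.KatoDescentTamePotSupersingular.TameUpperNonsurjTower :=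
  tameUpperNonsurjTower_of_cm_of_properModP_nonCM hCM hmod hGZK fun W _ _ p _ hr hp2 hadd hT hcm hI hsp ↦ by
    have hO5 : ClassO5 W p := ⟨hp2, hadd, Or.inr hT⟩
    obtain ⟨D, hDof⟩ := hreal W p hp2 hadd hO5.padicValRat_j_nonneg hI
    exact missingUpperBoundAt_tame_irreducible_of_muInvariant_le_one_of_even hR hdiv hz hCT hGZK hmod W p
      hr hp2 hadd hT hI D hDof (hμ W p hr hp2 hadd hT hcm hI hsp D hDof)
      (heven W p hr hp2 hadd hT hcm hI hsp)

/-! ## §3 The same in the hull currency of crux M (kmc readings M1-irr, M2♭, Mμ, M3♯) -/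

/-- **The row crux `TameUpperNonsurjTower` FROM THE HULL READINGS WITH COATES–SUJATHA'S CONJECTURE A ON ITS
NON-CM ROWS** (the kmc seat's currency, `O6/X3KatoMemberBoundMuDefect.lean`): over Reading M1-irr (datum at
`W` itself for `E[p]` irreducible), Reading M2♭ (Thm. 12.5 (3), divisibility off `(p)`, image-free),
Reading Mμ (Conjecture A ⇒ `μ(𝐇²(T)⁰) = 0`), Reading M3♯ (the exact rank-`0` count), the CM triple (row
C8), GZK and modularity, the interface `FineMuZero W p` (o6-r1's binding: `Y(E/ℚ(μ_{p^∞}))` finitely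
generated over `ℤ_p`) asked ONLY on the non-CM rank-`0` (t′) rows with `E[p]` irreducible and `ρ̄_{E,p}` not
onto gives the crux BY NAME (`O6.irrUpper_of_hullReadings_of_fineMuZero` row by row). Conditional over
displayed readings; nothing asserted; the item is not closed.
[cite: Kato2004Asterisque, Thm. 12.5 (3), Thm. 12.6 (p. 222), Lemma 14.7 (p. 238), Prop. 14.16 (2) (p. 244)]
[cite: CoatesSujatha2005, Conjecture A] [cite: BurungaleFlach2024, Thm. 1.1 and Cor. 2 (p. 4)] -/
theorem tameUpperNonsurjTower_of_hullReadings_of_fineMuZero_nonCM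
    (hRi : KatoHull.RealizableOfIrr IsHullOf) (hoff : KatoHull.DivisibilityOffPReading IsHullOf)
    (hμ : KatoHull.MuH2ZeroReading IsHullOf FineMuZero) (hC : KatoHull.ExactCountReading IsHullOf)
    (hCM : bsdTriple_of_hasCM_of_L_one_ne_zero)
    (hGZK : rank_eq_analyticRank_of_analyticRank_le_one) (hmod : hasEntireLFunction_rat)
    (hfine : ∀ (W : WeierstrassCurve ℚ) [W.IsElliptic] [W.IsGloballyMinimal] (p : ℕ) [Fact p.Prime],
      W.analyticRank = 0 → p ≠ 2 → Addv W p → SubTprime W p → ¬ W.HasCM →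
      W.HasIrreducibleModPGaloisRep p → ¬ W.HasSurjectiveModNGaloisRep p → FineMuZero W p) :
    Summit.BirchSwinnertonDyer.BirchSwinnertonDyer.Theses.KatoDescentTamePotSupersingular.TameUpperNonsurjTower :=
  tameUpperNonsurjTower_of_cm_of_properModP_nonCM hCM hmod hGZK fun W _ _ p _ hr hp2 hadd hT hcm hI hsp ↦
    have hO5 : ClassO5 W p := ⟨hp2, hadd, Or.inr hT⟩
    O6.irrUpper_of_hullReadings_of_fineMuZero hRi hoff hμ hC hGZK hmod W p hp2 hadd.1 hadd.2
      hO5.padicValRat_j_nonneg hI (hfine W p hr hp2 hadd hT hcm hI hsp) hr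

/-! ## §4 The KMC_p shadow of the crux (no isogeny: `E[p]` irreducible gives `p ∤ #E(ℚ)_tors`) -/

/-- **The row crux `TameUpperNonsurjTower` ALSO FOLLOWS FROM KATO'S MAIN CONJECTURE 12.10 FOR `T_pE` AT ITS
OWN ROWS** (no isogeny, no torsion slack: `E[p]` irreducible gives `p ∤ #E(ℚ)_tors`, so the kmc seat's
torsion-free descent `TorsionFree.missingPPartAt_rankZero_of_kmc` — KMC ⇒ BOTH halves of `BSD(E,p)`,
image-free — applies at `W` itself) over the readings 1♭ / 3♭ and the interface lemma `ReadsTrivialKMC`, GZK,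
modularity. The KMC_p shadow of the item, parallel to the route's lower half `TameLowerHalfRankZero`
(`tameLowerHalfRankZero_of_kmc_torsionFree`); KMC is the hypothesis `hK`, D-O6-2 stands, nothing is credited.
[cite: Kato2004Asterisque, Conj. 12.10 (p. 224), §14.14 and Lemma 14.15 (pp. 243–244), Prop. 14.16 (2) (p. 244)] -/
theorem tameUpperNonsurjTower_of_kmc (hR : TorsionFree.DescentCountReading IsOf)
    (hreal : TorsionFree.RealizableOfKMC IsOf KMC) (hread : ReadsTrivialKMC IsOf KMC)
    (hGZK : rank_eq_analyticRank_of_analyticRank_le_one) (hmod : hasEntireLFunction_rat)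
    (hK : ∀ (W : WeierstrassCurve ℚ) [W.IsElliptic] [W.IsGloballyMinimal] (p : ℕ) [Fact p.Prime],
      W.analyticRank = 0 → p ≠ 2 → Addv W p → SubTprime W p → W.HasIrreducibleModPGaloisRep p →
      ¬ (∀ n : ℕ, W.HasSurjectiveModNGaloisRep (p ^ n : ℕ)) → KMC W p) :
    Summit.BirchSwinnertonDyer.BirchSwinnertonDyer.Theses.KatoDescentTamePotSupersingular.TameUpperNonsurjTower := by
  intro W _ _ p _ hr hp2 hadd hT hI hns
  have hO5 : ClassO5 W p := ⟨hp2, hadd, Or.inr hT⟩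
  have ht : ¬ p ∣ W.torsionOrder := Supersingular.not_dvd_torsionOrder_of_irr W p hI
  exact (lower_and_upper_of_missingPPartAt W p
    (TorsionFree.missingPPartAt_rankZero_of_kmc W p hR hreal hread hGZK hmod hr hp2 hadd
      hO5.padicValRat_j_nonneg ht (hK W p hr hp2 hadd hT hI hns))).2

end Summit.BirchSwinnertonDyer.BirchSwinnertonDyer.Theorems

end
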